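import Literature.NumberTheory.EllipticCurves.EisensteinSeriesTwoCharacter
import Literature.NumberTheory.EllipticCurves.WeierstrassPDivisionValuesAtImInfty
import HarnessLib

/-!
# The weight-`2` Eisenstein series `S_2^{ψ,φ}` with two characters from `℘`-division values

Topic `Literature/NumberTheory/EllipticCurves`; namespace
`Literature.NumberTheory.EllipticCurves.ModularForms`.  Definitions with bodies (`pdivZ`,
`twoCharTwo`, `twoCharTwoMF`, `twoCharTwoCusp`) and theorems; no named fact.

For Dirichlet characters `ψ` modulo `u` and `φ` modulo `v` we form, exactly as the coprime-pairs
series `E_k^{ψ,φ}` of weight `k ≥ 3` (`EisensteinSeriesTwoCharacter`), the combination of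
`℘`-division values (`WeierstrassPDivisionValues`)

  `S_2^{ψ,φ}(τ) = ∑_{c₁ mod u} ∑_{d₀ mod uv} ψ(c₁) φ̄(d₀) ℘_{Λ_τ}((v c₁ τ + d₀)/(uv))`

(`twoCharTwo`; Diamond–Shurman §4.6, (4.23)–(4.25) and §4.8: this is
`(uv)² G_2^{ψ,φ} = -8π² W(φ̄) (uv)² v⁻² E_2^{ψ,φ}` up to the constant term, which vanishes for
`u > 1`).  Since `f_v ∣₂ γ = f_{vγ}` for ALL `γ ∈ SL₂(ℤ)` (`weierstrassPDiv_slash`), the proofs of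
the weight-`k ≥ 3` file carry over verbatim:

* `twoCharTwo_slash_of_mem_gamma0` — `S ∣₂ γ = ψ(d) φ(d) S` for `γ ∈ Γ₀(uv)`;
* `twoCharTwoMF` — `S` as a modular form of weight `2` on `Γ₁(uv)` (holomorphy and boundedness at
  all cusps from `WeierstrassPDivisionValuesAtImInfty`);
* `tendsto_twoCharTwo_slash_atImInfty` — the limit `twoCharTwoCusp ψ φ γ` of `S ∣₂ γ` at `i∞` for
  every `γ ∈ SL₂(ℤ)` (a finite sum of the constants `K_v = weierstrassPDivConst`).

## References

* F. Diamond, J. Shurman, *A First Course in Modular Forms*, GTM 228 (2005), §1.5, §4.6, §4.8.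
  [DiamondShurman2005]
-/

noncomputable section

open UpperHalfPlane EisensteinSeries ModularForm CongruenceSubgroup Complex Filter Function Matrix

open scoped Real MatrixGroups Topology Manifold

namespace Literature.NumberTheory.EllipticCurves.ModularForms

/-! ### `℘`-division values indexed by `(ℤ/N)²` -/

section PDivZ

variable (N : ℕ) [NeZero N]

/-- The `℘`-division value `f_a`, `a ∈ (ℤ/N)²` (through the canonical representatives).
[cite: DiamondShurman2005, §1.5] -/
def pdivZ (a : Fin 2 → ZMod N) : ℍ → ℂ := weierstrassPDiv N fun i ↦ ((a i).val : ℤ)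

/-- `f_a` computed from any integer lift of `a`. [folklore] -/
theorem pdivZ_eq_of_intCast (a : Fin 2 → ZMod N) (w : Fin 2 → ℤ) (h : ∀ i, (w i : ZMod N) = a i) :
    pdivZ N a = weierstrassPDiv N w := by
  funext τ
  refine weierstrassPDiv_congr_mod (NeZero.ne N) (fun i ↦ ?_) τ
  rw [Int.cast_natCast, ZMod.natCast_zmod_val, h i]

/-- **`f_a ∣₂ γ = f_{aγ}`** for all `γ ∈ SL₂(ℤ)`. [cite: DiamondShurman2005, §1.5] -/
theorem pdivZ_slash (a : Fin 2 → ZMod N) (γ : SL(2, ℤ)) :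
    (pdivZ N a) ∣[(2 : ℤ)] γ = pdivZ N (a ᵥ* γ) := by
  rw [pdivZ, weierstrassPDiv_slash]
  symm
  refine pdivZ_eq_of_intCast N _ _ fun i ↦ ?_
  simp only [Matrix.vecMul, dotProduct, Fin.sum_univ_two, Int.cast_add, Int.cast_mul,
    Int.cast_natCast, ZMod.natCast_zmod_val]
  fin_cases i <;> simp

/-- The constant `K_a` of `f_a` at `i∞`. [cite: DiamondShurman2005, §4.6] -/
def pdivConstZ (a : Fin 2 → ZMod N) : ℂ := weierstrassPDivConst N fun i ↦ ((a i).val : ℤ)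

/-- **`f_a → K_a` at `i∞`.** [cite: DiamondShurman2005, §4.6] -/
theorem tendsto_pdivZ_atImInfty (a : Fin 2 → ZMod N) :
    Tendsto (pdivZ N a) atImInfty (𝓝 (pdivConstZ N a)) :=
  tendsto_weierstrassPDiv_atImInfty _

/-- `f_a` is holomorphic. [folklore] -/
theorem mdifferentiable_pdivZ (a : Fin 2 → ZMod N) : MDifferentiable 𝓘(ℂ) 𝓘(ℂ) (pdivZ N a) :=
  mdifferentiable_weierstrassPDiv _

end PDivZ

/-! ### The two-character combination -/

section TwoChar

variable {u v : ℕ} [NeZero u] [NeZero v] (ψ : DirichletCharacter ℂ u) (φ : DirichletCharacter ℂ v)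

/-- **`S_2^{ψ,φ} = ∑_{c₁ mod u} ∑_{d₀ mod uv} ψ(c₁) φ̄(d₀) f_{(vc₁,d₀)}`**, the two-character
combination of `℘`-division values of level `uv`. [cite: DiamondShurman2005, §4.6 (4.23)–(4.25), §4.8] -/
def twoCharTwo : ℍ → ℂ := fun z ↦
  ∑ c₁ : ZMod u, ∑ d₀ : ZMod (u * v), tcWeight ψ φ c₁ d₀ * pdivZ (u * v) (tcVec c₁ d₀) z

/-- `S_2^{ψ,φ}` as a sum of functions. [folklore] -/
theorem twoCharTwo_eq_sum : twoCharTwo ψ φ =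
    ∑ c₁ : ZMod u, ∑ d₀ : ZMod (u * v), tcWeight ψ φ c₁ d₀ • pdivZ (u * v) (tcVec c₁ d₀) := by
  funext z
  simp [twoCharTwo, Finset.sum_apply]

/-- **The nebentypus law**: `S ∣₂ γ = ψ(d) φ(d) S` for `γ = (a b; c d) ∈ Γ₀(uv)` (reindex
`(c₁, d₀) ↦ (c₁ a, d₀ d + v c₁ b)`, verbatim as for `E_k^{ψ,φ}`).
[cite: DiamondShurman2005, §4.6 (Thm. 4.6.2), §4.8] -/
theorem twoCharTwo_slash_of_mem_gamma0 {γ : SL(2, ℤ)} (hγ : γ ∈ Gamma0 (u * v)) :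
    twoCharTwo ψ φ ∣[(2 : ℤ)] γ =
      (ψ ((γ 1 1 : ℤ) : ZMod u) * φ ((γ 1 1 : ℤ) : ZMod v)) • twoCharTwo ψ φ := by
  have had_uv := apply_zero_zero_mul_apply_one_one_of_mem_gamma0 hγ
  have had_u : ((γ 0 0 : ℤ) : ZMod u) * ((γ 1 1 : ℤ) : ZMod u) = 1 := by
    have := congrArg (ZMod.castHom (dvd_mul_right u v) (ZMod u)) had_uv
    rwa [map_mul, map_intCast, map_intCast, map_one] at this
  have had_v : ((γ 0 0 : ℤ) : ZMod v) * ((γ 1 1 : ℤ) : ZMod v) = 1 := by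
    have := congrArg (ZMod.castHom (dvd_mul_left v u) (ZMod v)) had_uv
    rwa [map_mul, map_intCast, map_intCast, map_one] at this
  obtain ⟨dU, hdU⟩ : ∃ dU : (ZMod (u * v))ˣ, (dU : ZMod (u * v)) = ((γ 1 1 : ℤ) : ZMod (u * v)) :=
    ⟨Units.mkOfMulEqOne (((γ 1 1 : ℤ) : ZMod (u * v))) (((γ 0 0 : ℤ) : ZMod (u * v)))
      ((mul_comm _ _).trans had_uv), rfl⟩
  obtain ⟨aU, haU⟩ : ∃ aU : (ZMod u)ˣ, (aU : ZMod u) = ((γ 0 0 : ℤ) : ZMod u) :=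
    ⟨Units.mkOfMulEqOne (((γ 0 0 : ℤ) : ZMod u)) (((γ 1 1 : ℤ) : ZMod u)) had_u, rfl⟩
  rw [twoCharTwo_eq_sum, SlashAction.sum_slash, Finset.smul_sum]
  simp_rw [SlashAction.sum_slash, ModularForm.SL_smul_slash, pdivZ_slash,
    tcVec_vecMul_of_mem_gamma0 hγ, ← haU, ← hdU]
  refine Fintype.sum_equiv aU.mulRight _ _ fun c₁ ↦ ?_
  rw [Finset.smul_sum]
  refine Fintype.sum_equiv (dU.mulRight.trans (Equiv.addRight (vMul c₁ * ((γ 0 1 : ℤ) : ZMod (u * v)))))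
    _ _ fun d₀ ↦ ?_
  simp only [Equiv.trans_apply, Units.mulRight_apply, Equiv.coe_addRight, smul_smul]
  congr 1
  simp only [tcWeight, map_add, map_mul, castHom_vMul, zero_mul, add_zero, map_intCast, hdU, haU]
  rw [MulChar.inv_apply_eq_inv' φ (((γ 1 1 : ℤ) : ZMod v))]
  have hψ1 : ψ ((γ 1 1 : ℤ) : ZMod u) * ψ ((γ 0 0 : ℤ) : ZMod u) = 1 := by
    rw [← map_mul, mul_comm, had_u, map_one]
  have hφd : φ ((γ 1 1 : ℤ) : ZMod v) ≠ 0 := fun h ↦ by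
    have := congrArg φ had_v
    rw [map_mul, h, mul_zero, map_one] at this
    exact zero_ne_one this
  have h2 : φ ((γ 1 1 : ℤ) : ZMod v) * (φ⁻¹ (ZMod.castHom (dvd_mul_left v u) (ZMod v) d₀) *
      (φ ((γ 1 1 : ℤ) : ZMod v))⁻¹) = φ⁻¹ (ZMod.castHom (dvd_mul_left v u) (ZMod v) d₀) := by
    field_simp
  symm
  calc ψ ((γ 1 1 : ℤ) : ZMod u) * φ ((γ 1 1 : ℤ) : ZMod v) * (ψ c₁ * ψ ((γ 0 0 : ℤ) : ZMod u) *
        (φ⁻¹ (ZMod.castHom (dvd_mul_left v u) (ZMod v) d₀) * (φ ((γ 1 1 : ℤ) : ZMod v))⁻¹))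
      = (ψ ((γ 1 1 : ℤ) : ZMod u) * ψ ((γ 0 0 : ℤ) : ZMod u)) * (ψ c₁ * (φ ((γ 1 1 : ℤ) : ZMod v) *
          (φ⁻¹ (ZMod.castHom (dvd_mul_left v u) (ZMod v) d₀) * (φ ((γ 1 1 : ℤ) : ZMod v))⁻¹))) := by
        ring
    _ = ψ c₁ * φ⁻¹ (ZMod.castHom (dvd_mul_left v u) (ZMod v) d₀) := by rw [hψ1, h2, one_mul]

/-- Holomorphy of `S_2^{ψ,φ}`. [folklore] -/
theorem mdifferentiable_twoCharTwo : MDifferentiable 𝓘(ℂ) 𝓘(ℂ) (twoCharTwo ψ φ) := by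
  rw [twoCharTwo_eq_sum]
  have h1 : ∀ (c₁ : ZMod u) (s : Finset (ZMod (u * v))), MDifferentiable 𝓘(ℂ) 𝓘(ℂ)
      (∑ d₀ ∈ s, tcWeight ψ φ c₁ d₀ • pdivZ (u * v) (tcVec c₁ d₀)) := by
    intro c₁ s
    induction s using Finset.induction_on with
    | empty => simp only [Finset.sum_empty]; exact mdifferentiable_const
    | insert d₀ s hd ih =>
      rw [Finset.sum_insert hd]
      exact ((mdifferentiable_pdivZ _ _).const_smul _).add ih
  have h2 : ∀ s : Finset (ZMod u), MDifferentiable 𝓘(ℂ) 𝓘(ℂ)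
      (∑ c₁ ∈ s, ∑ d₀ : ZMod (u * v), tcWeight ψ φ c₁ d₀ • pdivZ (u * v) (tcVec c₁ d₀)) := by
    intro s
    induction s using Finset.induction_on with
    | empty => simp only [Finset.sum_empty]; exact mdifferentiable_const
    | insert c₁ s hc ih =>
      rw [Finset.sum_insert hc]
      exact (h1 c₁ _).add ih
  exact h2 _

/-- **The constant of `S ∣₂ γ` at `i∞`**, `∑ ψ(c₁) φ̄(d₀) K_{(vc₁,d₀)γ}`. [cite: DiamondShurman2005, §4.6] -/
def twoCharTwoCusp (γ : SL(2, ℤ)) : ℂ :=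
  ∑ c₁ : ZMod u, ∑ d₀ : ZMod (u * v),
    tcWeight ψ φ c₁ d₀ * pdivConstZ (u * v) ((tcVec c₁ d₀ : Fin 2 → ZMod (u * v)) ᵥ* γ)

/-- **`S ∣₂ γ → twoCharTwoCusp γ` at `i∞`** for every `γ ∈ SL₂(ℤ)`. [cite: DiamondShurman2005, §4.6] -/
theorem tendsto_twoCharTwo_slash_atImInfty (γ : SL(2, ℤ)) :
    Tendsto (twoCharTwo ψ φ ∣[(2 : ℤ)] γ) atImInfty (𝓝 (twoCharTwoCusp ψ φ γ)) := by
  rw [twoCharTwo_eq_sum, SlashAction.sum_slash]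
  simp_rw [SlashAction.sum_slash, ModularForm.SL_smul_slash, pdivZ_slash]
  unfold twoCharTwoCusp
  have : (fun z : ℍ ↦ ∑ c₁ : ZMod u, ∑ d₀ : ZMod (u * v), tcWeight ψ φ c₁ d₀ *
      pdivZ (u * v) ((tcVec c₁ d₀ : Fin 2 → ZMod (u * v)) ᵥ* γ) z) =
      ∑ c₁ : ZMod u, ∑ d₀ : ZMod (u * v),
        tcWeight ψ φ c₁ d₀ • pdivZ (u * v) ((tcVec c₁ d₀ : Fin 2 → ZMod (u * v)) ᵥ* γ) := by
    funext z; simp [Finset.sum_apply]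
  rw [← this]
  refine tendsto_finsetSum _ fun c₁ _ ↦ tendsto_finsetSum _ fun d₀ _ ↦ ?_
  exact (tendsto_pdivZ_atImInfty _ _).const_mul _

/-- Every `SL₂(ℤ)`-translate of `S_2^{ψ,φ}` is bounded at `i∞`. [folklore] -/
theorem isBoundedAtImInfty_twoCharTwo_slash (g : SL(2, ℤ)) :
    IsBoundedAtImInfty (twoCharTwo ψ φ ∣[(2 : ℤ)] g) :=
  (tendsto_twoCharTwo_slash_atImInfty ψ φ g).isBigO_one ℝ

/-- `S_2^{ψ,φ}` is invariant under `Γ₁(uv)`. [folklore] -/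
theorem twoCharTwo_slash_of_mem_gamma1 {γ : SL(2, ℤ)} (hγ : γ ∈ Gamma1 (u * v)) :
    twoCharTwo ψ φ ∣[(2 : ℤ)] γ = twoCharTwo ψ φ := by
  rw [Gamma1_mem] at hγ
  rw [twoCharTwo_slash_of_mem_gamma0 ψ φ (Gamma0_mem.2 hγ.2.2)]
  have hu : ((γ 1 1 : ℤ) : ZMod u) = 1 := by
    have := congrArg (ZMod.castHom (dvd_mul_right u v) (ZMod u)) hγ.2.1
    rwa [map_intCast, map_one] at this
  have hv : ((γ 1 1 : ℤ) : ZMod v) = 1 := by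
    have := congrArg (ZMod.castHom (dvd_mul_left v u) (ZMod v)) hγ.2.1
    rwa [map_intCast, map_one] at this
  rw [hu, hv, map_one, map_one, one_mul, one_smul]

/-- **`S_2^{ψ,φ}` as a modular form of weight `2` on `Γ₁(uv)`.**
[cite: DiamondShurman2005, §4.6 (Thm. 4.6.2), §4.8] -/
def twoCharTwoMF : ModularForm (Gamma1 (u * v)) 2 where
  toFun := twoCharTwo ψ φ
  slash_action_eq' A hA := by
    obtain ⟨A, (hA : A ∈ Gamma1 (u * v)), rfl⟩ := hA
    exact twoCharTwo_slash_of_mem_gamma1 ψ φ hA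
  holo' := mdifferentiable_twoCharTwo ψ φ
  bdd_at_cusps' {c} hc := by
    rw [Subgroup.IsArithmetic.isCusp_iff_isCusp_SL2Z] at hc
    rw [OnePoint.isBoundedAt_iff_forall_SL2Z hc]
    intro γ _
    exact isBoundedAtImInfty_twoCharTwo_slash ψ φ γ

/-- The function of `twoCharTwoMF`. [folklore] -/
@[simp] theorem coe_twoCharTwoMF : (⇑(twoCharTwoMF ψ φ) : ℍ → ℂ) = twoCharTwo ψ φ := rfl

/-- Nebentypus law for the modular form. [cite: DiamondShurman2005, Thm. 4.6.2] -/
theorem twoCharTwoMF_slash_of_mem_gamma0 {γ : SL(2, ℤ)} (hγ : γ ∈ Gamma0 (u * v)) :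
    (⇑(twoCharTwoMF ψ φ) : ℍ → ℂ) ∣[(2 : ℤ)] γ =
      (ψ ((γ 1 1 : ℤ) : ZMod u) * φ ((γ 1 1 : ℤ) : ZMod v)) • (⇑(twoCharTwoMF ψ φ) : ℍ → ℂ) :=
  twoCharTwo_slash_of_mem_gamma0 ψ φ hγ

/-- Limits of the modular form at the cusps. [cite: DiamondShurman2005, §4.6] -/
theorem tendsto_twoCharTwoMF_slash_atImInfty (γ : SL(2, ℤ)) :
    Tendsto ((⇑(twoCharTwoMF ψ φ) : ℍ → ℂ) ∣[(2 : ℤ)] γ) atImInfty (𝓝 (twoCharTwoCusp ψ φ γ)) :=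
  tendsto_twoCharTwo_slash_atImInfty ψ φ γ

end TwoChar

end Literature.NumberTheory.EllipticCurves.ModularForms
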